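import Literature.Geometry.Riemannian.NeumannBoundaryRepresentative
import Literature.Geometry.Riemannian.NeumannWeakLimitEquation
import Literature.Geometry.Lorentzian.HessianLinear
import HarnessLib

/-!
# A `C²` solution of the Neumann problem `f Δ_h u + ⟨∇f, ∇u⟩ = F`, `⟨∇u, ∇σ⟩ = 0 on {σ = 0}`
# on a connected regular sub-level domain (dimension four)

Topic `Geometry/Riemannian`. Theorem file (no definitions, no named facts; everything proved), on
the discharge path of `Literature.Geometry.Riemannian.sharpLogSobolevAVR_four`: the classical
solvability of the Neumann problem (Taylor, *PDE I*, Ch. 5 §7, Prop. 7.4 with (7.13)–(7.14) and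
the Fredholm alternative Prop. 7.5/7.7) in the form the tree affords — a `C²` solution.

`exists_contMDiff_two_neumann_solution`: on a `C^∞` manifold modelled on `ℝ⁴` with a Riemannian
metric with Levi-Civita connection, for `σ ∈ C^∞` with `{σ ≤ 0}` compact, `{σ < 0}` connected and
`dσ ≠ 0` on `{σ = 0}`, `f ∈ C^∞` positive and `F ∈ C^∞` with `∫_{σ<0} F dμ = 0`, there is
`u ∈ C²` with `f Δ_h u + h(∇f, ∇u) = F` on `{σ < 0}` and `h⁻¹(du, dσ) = 0` on `{σ = 0}`.
Proof: the weak solution (`NeumannWeakExistence.lean`), its local `C²` representatives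
(`NeumannBoundaryRepresentative.lean`) patched by a smooth partition of unity; the patched function
has, at every point of `{σ ≤ 0}`, the same `2`-jet as the local representative (two representatives
agree on the open set where both equal the weak solution a.e., hence, by continuity, up to the
boundary), so the pointwise equation (`NeumannWeakLimitEquation.lean`) and boundary condition
transfer.

## References

* M. E. Taylor, *Partial Differential Equations I*, 2nd ed. (2011), Ch. 5 §7. [TaylorPDEI2011]
* L. C. Evans, *Partial Differential Equations*, 2nd ed. (2010), §6.3. [Evans2010]
-/

noncomputable section

open MeasureTheory Measure Set Filter Metric Module InnerProductSpace TopologicalSpace Function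
open scoped ENNReal NNReal Manifold ContDiff Topology RealInnerProductSpace

namespace Literature.Geometry.Riemannian

open Lorentzian
open Bundle PseudoRiemannianMetric Literature.Analysis.FunctionSpaces

variable {m : ℕ} {M : Type*} [TopologicalSpace M] [ChartedSpace (EuclideanSpace ℝ (Fin m)) M]
  [IsManifold (𝓡 m) ∞ M]

/-- A point where `σ = 0` and `dσ ≠ 0` lies in the closure of `{σ < 0}`. [folklore] -/
theorem mem_closure_sublevel_of_mfderiv_ne_zero {σ : M → ℝ} (hσ : ContMDiff (𝓡 m) 𝓘(ℝ, ℝ) ∞ σ)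
    {q : M} (hq : σ q = 0) (hreg : mfderiv (𝓡 m) 𝓘(ℝ, ℝ) σ q ≠ 0) : q ∈ closure {x | σ x < 0} := by
  by_contra hcl
  have hN : {x | σ x < 0}ᶜ ∈ 𝓝 q := by
    have : (closure {x | σ x < 0})ᶜ ∈ 𝓝 q := isClosed_closure.isOpen_compl.mem_nhds hcl
    exact Filter.mem_of_superset this (compl_subset_compl.2 subset_closure)
  set φ := extChartAt (𝓡 m) q with hφ
  have hmd : MDifferentiableAt (𝓡 m) 𝓘(ℝ, ℝ) σ q := (hσ q).mdifferentiableAt (by simp)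
  have hd : DifferentiableAt ℝ (σ ∘ φ.symm) (φ q) :=
    differentiableAt_comp_extChartAt_symm_of_mem q (mem_extChartAt_source q) hmd
  have hloc : IsLocalMin (σ ∘ φ.symm) (φ q) := by
    have hc : ContinuousAt φ.symm (φ q) := continuousAt_extChartAt_symm q
    have h1 : ∀ᶠ y in 𝓝 (φ q), φ.symm y ∈ {x | σ x < 0}ᶜ := by
      refine hc.eventually_mem ?_
      rw [extChartAt_to_inv]; exact hN
    filter_upwards [h1] with y hy
    show σ (φ.symm (φ q)) ≤ σ (φ.symm y)
    rw [hφ, extChartAt_to_inv, hq]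
    exact not_lt.1 hy
  have h0 : fderiv ℝ (σ ∘ φ.symm) (φ q) = 0 := hloc.fderiv_eq_zero
  apply hreg
  rw [hmd.mfderiv]
  simp only [writtenInExtChartAt, extChartAt_model_space_eq_id, PartialEquiv.refl_coe,
    Function.id_comp, ModelWithCorners.Boundaryless.range_eq_univ, fderivWithin_univ]
  exact h0

variable [T2Space M] [LocallyCompactSpace M] [SigmaCompactSpace M] [MeasurableSpace M] [BorelSpace M]
  (g : PseudoRiemannianMetric (𝓡 m) ∞ (EuclideanSpace ℝ (Fin m)) (TangentSpace (𝓡 m) : M → Type _))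
  [g.HasLeviCivita]

omit [T2Space M] [LocallyCompactSpace M] [SigmaCompactSpace M] [MeasurableSpace M] [BorelSpace M] in
/-- **A `C²` function vanishing on an open set has vanishing Laplacian on its closure.**
[folklore] -/
theorem dalembertian_eq_zero_of_eqOn_zero {e : M → ℝ} (he : ContMDiff (𝓡 m) 𝓘(ℝ, ℝ) 2 e)
    {O : Set M} (hO : IsOpen O) (h0 : ∀ x ∈ O, e x = 0) {p : M} (hp : p ∈ closure O) :
    g.dalembertian e p = 0 := by
  have hc : Continuous (g.dalembertian e) := continuous_dalembertian g he
  have hzero : EqOn (g.dalembertian e) (fun _ ↦ (0 : ℝ)) O := fun x hx ↦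
    dalembertian_eq_zero_of_eventuallyEq_zero g (by
      filter_upwards [hO.mem_nhds hx] with y hy using h0 y hy)
  exact hzero.closure hc continuous_const hp

omit [T2Space M] [LocallyCompactSpace M] [SigmaCompactSpace M] [MeasurableSpace M] [BorelSpace M]
  [g.HasLeviCivita] in
/-- **A `C¹` function vanishing on an open set has vanishing pairing `h⁻¹(de, dX)` on its
closure.** [folklore] -/
theorem innerDual_mvfderiv_eq_zero_of_eqOn_zero {e X : M → ℝ} (he : ContMDiff (𝓡 m) 𝓘(ℝ, ℝ) 1 e)
    (hX : ContMDiff (𝓡 m) 𝓘(ℝ, ℝ) 1 X) {O : Set M} (hO : IsOpen O) (h0 : ∀ x ∈ O, e x = 0) {p : M}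
    (hp : p ∈ closure O) :
    g.innerDual p (mvfderiv (𝓡 m) e p).toLinearMap (mvfderiv (𝓡 m) X p).toLinearMap = 0 := by
  have hc := continuous_innerDual_mvfderiv g he hX
  have hzero : EqOn (fun x ↦ g.innerDual x (mvfderiv (𝓡 m) e x).toLinearMap
      (mvfderiv (𝓡 m) X x).toLinearMap) (fun _ ↦ (0 : ℝ)) O := fun x hx ↦ by
    have : mvfderiv (𝓡 m) e x = 0 := mvfderiv_eq_zero_of_eventuallyEq_zero (by
      filter_upwards [hO.mem_nhds hx] with y hy using h0 y hy)
    simp only [this, ContinuousLinearMap.toLinearMap_zero, PseudoRiemannianMetric.innerDual,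
      LinearMap.zero_apply]
  exact hzero.closure hc continuous_const hp

set_option maxHeartbeats 3200000 in
/-- **A `C²` solution of the Neumann problem on a connected regular sub-level domain**
(Taylor, *PDE I*, Ch. 5 §7, Prop. 7.4–7.7, in dimension four; see the module docstring).
[cite: TaylorPDEI2011, Ch. 5 §7, Propositions 7.4–7.7] -/
theorem exists_contMDiff_two_neumann_solution (hg : g.IsRiemannian)
    (hm4 : Module.finrank ℝ (EuclideanSpace ℝ (Fin m)) = 4)
    {σ : M → ℝ} (hσ : ContMDiff (𝓡 m) 𝓘(ℝ, ℝ) ∞ σ) (hcpt : IsCompact {x | σ x ≤ 0})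
    (hconn : IsConnected {x | σ x < 0}) (hreg : ∀ x, σ x = 0 → mvfderiv (𝓡 m) σ x ≠ 0)
    {f : M → ℝ} (hf : ContMDiff (𝓡 m) 𝓘(ℝ, ℝ) ∞ f) (hfpos : ∀ x, 0 < f x)
    {F : M → ℝ} (hF : ContMDiff (𝓡 m) 𝓘(ℝ, ℝ) ∞ F)
    (hmean : ∫ x in {x | σ x < 0}, F x ∂riemannianMeasure (g.toContMDiffRiemannianMetric hg) = 0) :
    ∃ u : M → ℝ, ContMDiff (𝓡 m) 𝓘(ℝ, ℝ) 2 u ∧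
      (∀ x, σ x < 0 → f x * g.dalembertian u x + g.val x (grad g f x) (grad g u x) = F x) ∧
      ∀ x, σ x = 0 → g.innerDual x (mvfderiv (𝓡 m) u x).toLinearMap
        (mvfderiv (𝓡 m) σ x).toLinearMap = 0 := by
  classical
  set h := g.toContMDiffRiemannianMetric hg with hh_def
  haveI : (ofRiemannian h).HasLeviCivita := ‹g.HasLeviCivita›
  set μ : Measure M := riemannianMeasure h with hμ
  haveI : μ.IsOpenPosMeasure := isOpenPosMeasure_riemannianMeasure h
  set D : Set M := {x | σ x < 0} with hD
  set K : Set M := {x | σ x ≤ 0} with hK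
  have hDo : IsOpen D := isOpen_lt hσ.continuous continuous_const
  have hDm : MeasurableSet D := hDo.measurableSet
  have hKcl : IsClosed K := isClosed_le hσ.continuous continuous_const
  have hDK : D ⊆ K := fun x (hx : σ x < 0) ↦ hx.le
  have hm : 0 < m := by
    have : Module.finrank ℝ (EuclideanSpace ℝ (Fin m)) = m := by simp
    omega
  have h1le : (1 : ℕ∞ω) ≤ 2 := by norm_cast
  have hf1 : ContMDiff (𝓡 m) 𝓘(ℝ, ℝ) 1 f := hf.of_le (by norm_cast)
  have hσ1 : ContMDiff (𝓡 m) 𝓘(ℝ, ℝ) 1 σ := hσ.of_le (by norm_cast)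
  /- Step 1: the weak solution -/
  obtain ⟨u, v, hus, hvm, hL2, hE, hweak⟩ := exists_smooth_weakNeumann_approx g hg hσ hcpt hconn
    hreg hf.continuous hfpos hF.continuous hmean
  /- Step 2: local representatives at every point of `K` -/
  have hloc : ∀ x ∈ K, ∃ V : Set M, IsOpen V ∧ x ∈ V ∧ ∃ w : M → ℝ,
      ContMDiff (𝓡 m) 𝓘(ℝ, ℝ) 2 w ∧ (∀ᵐ p ∂μ, p ∈ V → σ p < 0 → w p = v p) ∧
      ∀ q ∈ V, σ q = 0 → g.innerDual q (mvfderiv (𝓡 m) w q).toLinearMap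
        (mvfderiv (𝓡 m) σ q).toLinearMap = 0 := by
    intro x hx
    rcases (show σ x ≤ 0 from hx).lt_or_eq with hlt | heq
    · obtain ⟨V, hVo, hxV, hVD, w, hw, hae⟩ := exists_interior_representative g hg hm hσ hcpt hus
        hvm hL2 hE hf hfpos hF hweak hlt
      refine ⟨V, hVo, hxV, w, hw, ?_, fun q hq hq0 ↦ absurd hq0 (ne_of_lt (hVD hq))⟩
      filter_upwards [hae] with p hp hpV _ using hp hpV
    · have hreg' : mfderiv (𝓡 m) 𝓘(ℝ, ℝ) σ x ≠ 0 := fun h0 ↦ hreg x heq (by simp [mvfderiv, h0])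
      obtain ⟨V, hVo, hxV, w, hw, hae, hbc⟩ := exists_boundary_representative g hg hm4 hσ hcpt hus
        hvm hL2 hE hf hfpos hF hweak heq hreg'
      exact ⟨V, hVo, hxV, w, hw, hae, hbc⟩
  choose! V hVo hxV w hw hae hbc using hloc
  /- Step 3: a finite subcover and a partition of unity -/
  obtain ⟨t, htK, htfin, hcover⟩ := hcpt.elim_finite_subcover_image (fun x hx ↦ hVo x hx)
    (fun x hx ↦ mem_biUnion hx (hxV x hx))
  haveI : Fintype t := htfin.fintype
  -- index type `Option t`; `none` carries the exterior `Kᶜ` with the zero function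
  set U : Option t → Set M := fun o ↦ Option.elim o Kᶜ (fun i ↦ V i) with hU
  set W : Option t → M → ℝ := fun o ↦ Option.elim o (fun _ ↦ 0) (fun i ↦ w i) with hW
  have hUo : ∀ o, IsOpen (U o) := by
    rintro (_ | i)
    · exact hKcl.isOpen_compl
    · exact hVo i (htK i.2)
  have hUcov : (univ : Set M) ⊆ ⋃ o, U o := by
    intro x _
    by_cases hx : x ∈ K
    · obtain ⟨i, hi, hxi⟩ := mem_iUnion₂.1 (hcover hx)
      exact mem_iUnion.2 ⟨some ⟨i, hi⟩, hxi⟩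
    · exact mem_iUnion.2 ⟨none, hx⟩
  obtain ⟨ρ, hρU⟩ := SmoothPartitionOfUnity.exists_isSubordinate (𝓡 m) isClosed_univ U hUo hUcov
  have hWC : ∀ o, ContMDiff (𝓡 m) 𝓘(ℝ, ℝ) 2 (W o) := by
    rintro (_ | i)
    · exact contMDiff_const
    · exact hw i (htK i.2)
  set ut : M → ℝ := fun x ↦ ∑ᶠ o, ρ o x • W o x with hut
  have hutC : ContMDiff (𝓡 m) 𝓘(ℝ, ℝ) 2 ut :=
    ρ.contMDiff_finsum_smul fun o x _ ↦ (hWC o).contMDiffAt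
  have hut_sum : ∀ x, ut x = ∑ o, ρ o x * W o x := fun x ↦ by
    rw [hut]; simp only [smul_eq_mul]; exact finsum_eq_sum_of_fintype _
  /- Step 4: two representatives agree on `D ∩ V_i ∩ V_j` -/
  have hagree : ∀ i ∈ t, ∀ j ∈ t, ∀ x ∈ D ∩ V i ∩ V j, w i x = w j x := by
    intro i hi j hj
    have hOo : IsOpen (D ∩ V i ∩ V j) := (hDo.inter (hVo i (htK hi))).inter (hVo j (htK hj))
    have hae2 : (w i) =ᵐ[μ.restrict (D ∩ V i ∩ V j)] (w j) := by
      rw [EventuallyEq, ae_restrict_iff' hOo.measurableSet]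
      filter_upwards [hae i (htK hi), hae j (htK hj)] with x hxi hxj hx
      rw [hxi hx.1.2 hx.1.1, hxj hx.2 hx.1.1]
    exact Measure.eqOn_open_of_ae_eq hae2 hOo (hw i (htK hi)).continuous.continuousOn
      (hw j (htK hj)).continuous.continuousOn
  /- Step 5: the `2`-jet of `ut` at a point of `K` is that of a local representative -/
  have hjet : ∀ p ∈ K, ∀ j ∈ t, p ∈ V j → ∃ O : Set M, IsOpen O ∧ O ⊆ D ∩ V j ∧
      p ∈ closure O ∧ ∀ x ∈ O, ut x - w j x = 0 := by
    intro p hp j hj hpj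
    -- the neighbourhoods `N o` of `p`
    set N : Option t → Set M := fun o ↦ if p ∈ tsupport (ρ o) then U o else (tsupport (ρ o))ᶜ
      with hN
    have hNo : ∀ o, IsOpen (N o) := fun o ↦ by
      simp only [hN]; split_ifs
      · exact hUo o
      · exact (isClosed_tsupport _).isOpen_compl
    have hpN : ∀ o, p ∈ N o := fun o ↦ by
      simp only [hN]; split_ifs with h'
      · exact hρU o h'
      · exact h'
    set O : Set M := D ∩ V j ∩ ⋂ o, N o with hO
    have hOo : IsOpen O := (hDo.inter (hVo j (htK hj))).inter (isOpen_iInter_of_finite hNo)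
    refine ⟨O, hOo, inter_subset_left, ?_, fun x hx ↦ ?_⟩
    · -- `p ∈ closure O`
      have hpD : p ∈ closure D := by
        rcases (show σ p ≤ 0 from hp).lt_or_eq with hlt | heq
        · exact subset_closure hlt
        · exact mem_closure_sublevel_of_mfderiv_ne_zero hσ heq fun h0 ↦ hreg p heq
            (by simp [mvfderiv, h0])
      have hopen : IsOpen (V j ∩ ⋂ o, N o) := (hVo j (htK hj)).inter (isOpen_iInter_of_finite hNo)
      have hmem : p ∈ (V j ∩ ⋂ o, N o) ∩ closure D := ⟨⟨hpj, mem_iInter.2 hpN⟩, hpD⟩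
      have := hopen.inter_closure hmem
      rw [hO, show D ∩ V j ∩ ⋂ o, N o = (V j ∩ ⋂ o, N o) ∩ D by ac_rfl]
      exact this
    · -- `ut - w j` vanishes on `O`
      obtain ⟨⟨hxD, hxj⟩, hxN⟩ := hx
      have hxN' : ∀ o, x ∈ N o := fun o ↦ mem_iInter.1 hxN o
      have hterm : ∀ o, ρ o x * W o x = ρ o x * w j x := by
        intro o
        by_cases hpo : p ∈ tsupport (ρ o)
        · have hxU : x ∈ U o := by have := hxN' o; simp only [hN, if_pos hpo] at this; exact this
          rcases o with _ | i
          · exact absurd (hDK hxD) hxU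
          · show ρ (some i) x * w i x = ρ (some i) x * w j x
            rw [hagree i i.2 j hj x ⟨⟨hxD, hxU⟩, hxj⟩]
        · have hxs : x ∉ tsupport (ρ o) := by
            have := hxN' o; simp only [hN, if_neg hpo] at this; exact this
          rw [image_eq_zero_of_notMem_tsupport hxs, zero_mul, zero_mul]
      rw [hut_sum, Finset.sum_congr rfl fun o _ ↦ hterm o, ← Finset.sum_mul]
      have h1 : ∑ o, ρ o x = 1 := by
        have := ρ.sum_eq_one (mem_univ x)
        rwa [finsum_eq_sum_of_fintype] at this
      rw [h1, one_mul, sub_self]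
  /- Step 6: conclusion -/
  refine ⟨ut, hutC, fun p hp ↦ ?_, fun p hp ↦ ?_⟩
  · -- the equation at an interior point
    obtain ⟨j, hj, hpj⟩ := mem_iUnion₂.1 (hcover (hDK hp))
    obtain ⟨O, hOo, hOsub, hpO, hO0⟩ := hjet p (hDK hp) j hj hpj
    -- the equation for `w j` on `D ∩ V j`
    have hPDE := dalembertian_eq_of_weakNeumann_limit g hg hDm hcpt hDK hus hvm hL2 hf hF.continuous
      hweak (hw j (htK hj)) (hDo.inter (hVo j (htK hj))) inter_subset_left (by
        filter_upwards [hae j (htK hj)] with x hx hxO using hx hxO.2 hxO.1) p ⟨hp, hpj⟩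
    -- the `2`-jet of `e = ut - w j` vanishes at `p`
    set e : M → ℝ := fun x ↦ ut x - w j x with he_def
    have heC : ContMDiff (𝓡 m) 𝓘(ℝ, ℝ) 2 e := hutC.sub (hw j (htK hj))
    have hΔe : g.dalembertian e p = 0 := dalembertian_eq_zero_of_eqOn_zero g heC hOo hO0 hpO
    have hde : g.innerDual p (mvfderiv (𝓡 m) e p).toLinearMap (mvfderiv (𝓡 m) f p).toLinearMap = 0 :=
      innerDual_mvfderiv_eq_zero_of_eqOn_zero g (heC.of_le h1le) hf1 hOo hO0 hpO
    -- linearity at `p`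
    have hsplit : ut = fun x ↦ w j x + 1 * e x := funext fun x ↦ by simp [he_def]
    have hΔ : g.dalembertian ut p = g.dalembertian (w j) p + g.dalembertian e p := by
      rw [hsplit, dalembertian_add_const_mul_of_contMDiffAt g ((hw j (htK hj)) p) (heC p) 1, one_mul]
    have hgrad : g.val p (grad g f p) (grad g ut p) =
        g.val p (grad g f p) (grad g (w j) p) + g.innerDual p (mvfderiv (𝓡 m) e p).toLinearMap
          (mvfderiv (𝓡 m) f p).toLinearMap := by
      rw [val_grad, val_grad, PseudoRiemannianMetric.innerDual_comm]
      have hd : mvfderiv (𝓡 m) ut p = mvfderiv (𝓡 m) (w j) p + mvfderiv (𝓡 m) e p := by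
        have e1 : ut = (w j) + e := funext fun x ↦ by simp [he_def]
        rw [e1]
        exact mvfderiv_add (((hw j (htK hj)) p).mdifferentiableAt (by norm_cast))
          ((heC p).mdifferentiableAt (by norm_cast))
      show mvfderiv (𝓡 m) f p (grad g ut p) = mvfderiv (𝓡 m) f p (grad g (w j) p) +
        (mvfderiv (𝓡 m) f p).toLinearMap (g.sharp p (mvfderiv (𝓡 m) e p).toLinearMap)
      rw [show grad g ut p = g.sharp p (mvfderiv (𝓡 m) ut p).toLinearMap from rfl, hd,
        ContinuousLinearMap.toLinearMap_add, map_add, map_add]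
      rfl
    rw [hΔ, hgrad, hΔe, hde, mul_add, mul_zero, add_zero, add_zero]
    exact hPDE
  · -- the boundary condition at a boundary point
    have hpK : p ∈ K := le_of_eq hp
    obtain ⟨j, hj, hpj⟩ := mem_iUnion₂.1 (hcover hpK)
    obtain ⟨O, hOo, -, hpO, hO0⟩ := hjet p hpK j hj hpj
    set e : M → ℝ := fun x ↦ ut x - w j x with he_def
    have heC : ContMDiff (𝓡 m) 𝓘(ℝ, ℝ) 2 e := hutC.sub (hw j (htK hj))
    have hde : g.innerDual p (mvfderiv (𝓡 m) e p).toLinearMap (mvfderiv (𝓡 m) σ p).toLinearMap = 0 :=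
      innerDual_mvfderiv_eq_zero_of_eqOn_zero g (heC.of_le h1le) hσ1 hOo hO0 hpO
    have hbcj := hbc j (htK hj) p hpj hp
    have hd : mvfderiv (𝓡 m) ut p = mvfderiv (𝓡 m) (w j) p + mvfderiv (𝓡 m) e p := by
      have e1 : ut = (w j) + e := funext fun x ↦ by simp [he_def]
      rw [e1]
      exact mvfderiv_add (((hw j (htK hj)) p).mdifferentiableAt (by norm_cast))
        ((heC p).mdifferentiableAt (by norm_cast))
    rw [hd, ContinuousLinearMap.toLinearMap_add]
    show ((mvfderiv (𝓡 m) (w j) p).toLinearMap + (mvfderiv (𝓡 m) e p).toLinearMap)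
      (g.sharp p (mvfderiv (𝓡 m) σ p).toLinearMap) = 0
    rw [LinearMap.add_apply]
    change g.innerDual p (mvfderiv (𝓡 m) (w j) p).toLinearMap (mvfderiv (𝓡 m) σ p).toLinearMap +
      g.innerDual p (mvfderiv (𝓡 m) e p).toLinearMap (mvfderiv (𝓡 m) σ p).toLinearMap = 0
    rw [hbcj, hde, add_zero]

end Literature.Geometry.Riemannian

end
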